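import Mathlib
import Literature.Computability.AlgebraicComplexity.PIProof
import Literature.Computability.AlgebraicComplexity.SymmetricArithCircuit

/-!
# Route ProofCarryingSymmetry — crux `RestorationQP`, line `registered`, stub S3 (`stub_stabilityAtACBudget`), part 1:
Hrubeš–Tzameret formulas modulo associativity and commutativity

Stub S3 of the line (`Cruxes/RestorationQP/Lines/birth.lean`) says: if every invariance identity
`C ∘ σ = C` of a `PICircuit` has a `P_c(ℂ)`-proof using only A1–A5 (reflexivity, commutativity,
associativity of `+` and `×`), C1/C2 (unsharing) and the rules R1–R4, then the AC-canonical form of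
`C` is an `S_n`-symmetric Dawar–Wilsenach circuit of size polynomial in `|C| + n`.  This file is the
term-level groundwork, for formulas `PIFormula 𝔽 X` over any constants and variables:

* `ACEq` — the congruence on formulas generated by A2–A5 (the "AC fragment" of `P_f`), an
  equivalence relation (`acSetoid`); it preserves `size`, `eval`, and the HEAD LABEL
  (`headLabel : PIFormula → CircuitLabel`, reusing Dawar–Wilsenach's gate labels `var x | const c |
  add | mul`), so leaves are AC-rigid (`ACEq.eq_of_var`, `ACEq.eq_of_const`), and it is stable under
  renaming of the variables (`ACEq.rename`);
* AC-SOUNDNESS: if a `P_c` proof of `F = G` contains no instance of A6 (distributivity), A7–A9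
  (unit laws) or A10 (constant equations) — the axiom budget of stubs S2/S3, `0` on these schemes
  and unconstrained on A1–A5, C1, C2 — then `F` and `G` unfold to AC-equivalent formulas
  (`acEq_unfold_of_pcProof`, by induction on the proof as for soundness, HT Prop. 1.1; C1/C2
  instances have literally equal unfoldings, `PICircuit.IsExtra.unfold_eq`), whence
  `acEq_unfold_of_hasPCProof` and the registered helper `stabilityAtACBudget_aux_acSound`.
  (Flattening and the quotient DAG are in part 2, `…ACFlatten.lean`.)

Everything is elementary and proved; no named facts.  (HT = Hrubeš–Tzameret, arXiv:1112.6265 §1.1;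
DW = Dawar–Wilsenach, ToC 2025, Def. 2.2.)
-/

-- single-problem summit: `Summit.ValiantsHypothesis.ValiantsHypothesis.…` is the namespace by design (D-0017)
set_option linter.dupNamespace false

namespace Summit.ValiantsHypothesis.ValiantsHypothesis.Theorems

namespace ACStability

open Literature.Computability.AlgebraicComplexity

universe u v w

variable {𝔽 : Type u} {X : Type v} {Y : Type w}

/-! ### The AC congruence -/

/-- `ACEq F G`: `F = G` is derivable in the fragment of Hrubeš–Tzameret's `P_f` with the axioms
A1 `F = F`, A2 `F+G = G+F`, A3 `F+(G+H) = (F+G)+H`, A4 `FG = GF`, A5 `F(GH) = (FG)H` and the rules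
R1–R4 (symmetry, transitivity, the two congruences) — equality of formulas modulo associativity
and commutativity of both operations. [folklore] -/
inductive ACEq : PIFormula 𝔽 X → PIFormula 𝔽 X → Prop
  /-- A1 -/
  | refl (F : PIFormula 𝔽 X) : ACEq F F
  /-- R1 -/
  | symm {F G : PIFormula 𝔽 X} : ACEq F G → ACEq G F
  /-- R2 -/
  | trans {F G H : PIFormula 𝔽 X} : ACEq F G → ACEq G H → ACEq F H
  /-- R3 -/
  | add_congr {F F' G G' : PIFormula 𝔽 X} : ACEq F F' → ACEq G G' → ACEq (.add F G) (.add F' G')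
  /-- R4 -/
  | mul_congr {F F' G G' : PIFormula 𝔽 X} : ACEq F F' → ACEq G G' → ACEq (.mul F G) (.mul F' G')
  /-- A2 -/
  | add_comm (F G : PIFormula 𝔽 X) : ACEq (.add F G) (.add G F)
  /-- A3 -/
  | add_assoc (F G H : PIFormula 𝔽 X) : ACEq (.add F (.add G H)) (.add (.add F G) H)
  /-- A4 -/
  | mul_comm (F G : PIFormula 𝔽 X) : ACEq (.mul F G) (.mul G F)
  /-- A5 -/
  | mul_assoc (F G H : PIFormula 𝔽 X) : ACEq (.mul F (.mul G H)) (.mul (.mul F G) H)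

/-- `ACEq` as a setoid on formulas. [folklore] -/
def acSetoid (𝔽 : Type u) (X : Type v) : Setoid (PIFormula 𝔽 X) where
  r := ACEq
  iseqv := ⟨ACEq.refl, ACEq.symm, ACEq.trans⟩

/-! ### Invariants: size, value, head label -/

/-- The head label of a formula: the Dawar–Wilsenach gate label of its root (`var x`, `const c`,
`+`, `×`). [folklore] -/
def headLabel : PIFormula 𝔽 X → CircuitLabel 𝔽 X
  | .var x => .var x
  | .const c => .const c
  | .add _ _ => .add
  | .mul _ _ => .mul

/-- Unfolding of `headLabel`. [folklore] -/
@[simp] theorem headLabel_var (x : X) : headLabel (.var x : PIFormula 𝔽 X) = .var x := rfl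
/-- Unfolding of `headLabel`. [folklore] -/
@[simp] theorem headLabel_const (c : 𝔽) : headLabel (.const c : PIFormula 𝔽 X) = .const c := rfl
/-- Unfolding of `headLabel`. [folklore] -/
@[simp] theorem headLabel_add (F G : PIFormula 𝔽 X) : headLabel (.add F G) = .add := rfl
/-- Unfolding of `headLabel`. [folklore] -/
@[simp] theorem headLabel_mul (F G : PIFormula 𝔽 X) : headLabel (.mul F G) = .mul := rfl

/-- AC-equivalent formulas have the same size. [folklore] -/
theorem ACEq.size_eq {F G : PIFormula 𝔽 X} (h : ACEq F G) : F.size = G.size := by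
  induction h with
  | refl F => rfl
  | symm _ ih => exact ih.symm
  | trans _ _ ih₁ ih₂ => exact ih₁.trans ih₂
  | add_congr _ _ ih₁ ih₂ => simp [ih₁, ih₂]
  | mul_congr _ _ ih₁ ih₂ => simp [ih₁, ih₂]
  | add_comm F G => simp; omega
  | add_assoc F G H => simp; omega
  | mul_comm F G => simp; omega
  | mul_assoc F G H => simp; omega

/-- AC-equivalent formulas compute the same polynomial (soundness of A2–A5). [folklore] -/
theorem ACEq.eval_eq [CommSemiring 𝔽] {F G : PIFormula 𝔽 X} (h : ACEq F G) : F.eval = G.eval := by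
  induction h with
  | refl F => rfl
  | symm _ ih => exact ih.symm
  | trans _ _ ih₁ ih₂ => exact ih₁.trans ih₂
  | add_congr _ _ ih₁ ih₂ => simp [ih₁, ih₂]
  | mul_congr _ _ ih₁ ih₂ => simp [ih₁, ih₂]
  | add_comm F G => simpa using _root_.add_comm F.eval G.eval
  | add_assoc F G H => simpa using (_root_.add_assoc F.eval G.eval H.eval).symm
  | mul_comm F G => simpa using _root_.mul_comm F.eval G.eval
  | mul_assoc F G H => simpa using (_root_.mul_assoc F.eval G.eval H.eval).symm

/-- AC-equivalent formulas have the same head label. [folklore] -/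
theorem ACEq.headLabel_eq {F G : PIFormula 𝔽 X} (h : ACEq F G) : headLabel F = headLabel G := by
  induction h with
  | refl F => rfl
  | symm _ ih => exact ih.symm
  | trans _ _ ih₁ ih₂ => exact ih₁.trans ih₂
  | _ => rfl

/-- Leaves are AC-rigid: only `var x` is AC-equivalent to `var x`. [folklore] -/
theorem ACEq.eq_of_var {x : X} {G : PIFormula 𝔽 X} (h : ACEq (.var x) G) : G = .var x := by
  have hl := h.headLabel_eq
  cases G <;> simp_all [headLabel]

/-- Leaves are AC-rigid: only `const c` is AC-equivalent to `const c`. [folklore] -/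
theorem ACEq.eq_of_const {c : 𝔽} {G : PIFormula 𝔽 X} (h : ACEq (.const c) G) : G = .const c := by
  have hl := h.headLabel_eq
  cases G <;> simp_all [headLabel]

/-- `ACEq` is stable under renaming of the variables. [folklore] -/
theorem ACEq.rename (f : X → Y) {F G : PIFormula 𝔽 X} (h : ACEq F G) :
    ACEq (F.rename f) (G.rename f) := by
  induction h with
  | refl F => exact .refl _
  | symm _ ih => exact ih.symm
  | trans _ _ ih₁ ih₂ => exact ih₁.trans ih₂
  | add_congr _ _ ih₁ ih₂ => exact .add_congr ih₁ ih₂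
  | mul_congr _ _ ih₁ ih₂ => exact .mul_congr ih₁ ih₂
  | add_comm F G => exact .add_comm _ _
  | add_assoc F G H => exact .add_assoc _ _ _
  | mul_comm F G => exact .mul_comm _ _
  | mul_assoc F G H => exact .mul_assoc _ _ _

/-- Renaming does not change the head symbol, and relabels a variable head. [folklore] -/
theorem headLabel_rename {Γ : Type*} [Group Γ] [MulAction Γ X] (γ : Γ) (F : PIFormula 𝔽 X) :
    headLabel (F.rename fun x => γ • x) = γ • headLabel F := by
  cases F <;> rfl

/-- `rename` along the identity. [folklore] -/
theorem rename_id' (F : PIFormula 𝔽 X) : F.rename (fun x => x) = F := by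
  induction F with
  | var x => rfl
  | const c => rfl
  | add F G ihF ihG => simp only [PIFormula.rename, ihF, ihG]
  | mul F G ihF ihG => simp only [PIFormula.rename, ihF, ihG]

/-- `rename` is functorial. [folklore] -/
theorem rename_rename' {Z : Type*} (f : X → Y) (g : Y → Z) (F : PIFormula 𝔽 X) :
    (F.rename f).rename g = F.rename (g ∘ f) := by
  induction F with
  | var x => rfl
  | const c => rfl
  | add F G ihF ihG => simp only [PIFormula.rename, ihF, ihG]
  | mul F G ihF ihG => simp only [PIFormula.rename, ihF, ihG]

/-! ### AC-soundness of `P_c` proofs that use no instance of A6–A10 -/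

section Sound

variable [CommSemiring 𝔽]

/-- The schemes outside the AC fragment: A6 (distributivity), A7–A9 (unit laws), A10 (constant
equations). [folklore] -/
def IsNonAC (s : PIAxiom) : Prop :=
  s = PIAxiom.A6 ∨ s = PIAxiom.A7 ∨ s = PIAxiom.A8 ∨ s = PIAxiom.A9 ∨ s = PIAxiom.A10

/-- An A1–A5 instance on circuits relates circuits with AC-equivalent unfoldings; an A6–A10
instance is excluded by hypothesis. [folklore] -/
theorem acEq_unfold_of_ringAxiom {s : PIAxiom} (hs : ¬ IsNonAC s) {F G : PICircuit 𝔽 X}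
    (h : (pcSystem 𝔽 X).RingAxiom s F G) : ACEq F.unfold G.unfold := by
  cases h with
  | a1 F => exact .refl _
  | a2 F G => simpa [pcSystem] using ACEq.add_comm F.unfold G.unfold
  | a3 F G H => simpa [pcSystem] using ACEq.add_assoc F.unfold G.unfold H.unfold
  | a4 F G => simpa [pcSystem] using ACEq.mul_comm F.unfold G.unfold
  | a5 F G H => simpa [pcSystem] using ACEq.mul_assoc F.unfold G.unfold H.unfold
  | _ => exact absurd (by simp [IsNonAC]) hs

/-- **AC-soundness.** In a `P_c` proof with no instance of A6–A10, both sides of every line unfold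
to AC-equivalent formulas (induction on the proof, as for soundness, HT Prop. 1.1; C1/C2 instances
have literally equal unfoldings). [folklore] -/
theorem acEq_unfold_of_pcProof {Γ : List (PICircuit 𝔽 X × PICircuit 𝔽 X)} (π : PCProof 𝔽 X Γ)
    (h : ∀ s, IsNonAC s → π.axiomCount s = 0) :
    ∀ {F G : PICircuit 𝔽 X}, (F, G) ∈ Γ → ACEq F.unfold G.unfold := by
  induction π with
  | nil => intro F G hm; simp at hm
  | axm s' hax π ih =>
    intro F G hm
    have hπ : ∀ s, IsNonAC s → π.axiomCount s = 0 := fun s hs => by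
      have := h s hs; simp only [PIProof.axiomCount] at this; omega
    have hs' : ¬ IsNonAC s' := fun hs => by
      have := h s' hs; simp [PIProof.axiomCount] at this
    rcases List.mem_cons.1 hm with hm | hm
    · obtain ⟨rfl, rfl⟩ := Prod.mk.injEq _ _ _ _ ▸ hm
      rcases hax with hax | hax
      · exact acEq_unfold_of_ringAxiom hs' hax
      · rw [show F.unfold = G.unfold from PICircuit.IsExtra.unfold_eq hax]; exact .refl _
    · exact ih hπ hm
  | symm hm' π ih =>
    intro F G hm
    rcases List.mem_cons.1 hm with hm | hm
    · obtain ⟨rfl, rfl⟩ := Prod.mk.injEq _ _ _ _ ▸ hm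
      exact (ih h hm').symm
    · exact ih h hm
  | trans h₁ h₂ π ih =>
    intro F G hm
    rcases List.mem_cons.1 hm with hm | hm
    · obtain ⟨rfl, rfl⟩ := Prod.mk.injEq _ _ _ _ ▸ hm
      exact (ih h h₁).trans (ih h h₂)
    · exact ih h hm
  | addRule h₁ h₂ hF hG π ih =>
    intro F G hm
    rcases List.mem_cons.1 hm with hm | hm
    · obtain ⟨rfl, rfl⟩ := Prod.mk.injEq _ _ _ _ ▸ hm
      subst hF hG
      simpa [pcSystem] using ACEq.add_congr (ih h h₁) (ih h h₂)
    · exact ih h hm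
  | mulRule h₁ h₂ hF hG π ih =>
    intro F G hm
    rcases List.mem_cons.1 hm with hm | hm
    · obtain ⟨rfl, rfl⟩ := Prod.mk.injEq _ _ _ _ ▸ hm
      subst hF hG
      simpa [pcSystem] using ACEq.mul_congr (ih h h₁) (ih h h₂)
    · exact ih h hm

/-- If `F = G` has a `P_c` proof within a budget that is `0` on A6–A10, then `F` and `G` unfold to
AC-equivalent formulas. [folklore] -/
theorem acEq_unfold_of_hasPCProof {F G : PICircuit 𝔽 X} {b : PIAxiom → ℕ∞}
    (hb : ∀ s, IsNonAC s → b s = 0) (h : HasPCProof F G b) : ACEq F.unfold G.unfold := by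
  obtain ⟨Γ, π, -, hπ⟩ := h
  refine acEq_unfold_of_pcProof π (fun s hs => ?_) List.mem_cons_self
  have := hπ s
  rw [hb s hs, nonpos_iff_eq_zero, Nat.cast_eq_zero] at this
  exact this

end Sound

end ACStability

open Literature.Computability.AlgebraicComplexity in
/-- **AC-soundness for the line's budget** (registered helper of stub S3 `stub_stabilityAtACBudget`,
crux `RestorationQP`): a `P_c(ℂ)` proof of `F = G` using no instance of A6–A10 forces the unfoldings
of `F` and `G` to be equal modulo associativity and commutativity. [folklore] -/
theorem stabilityAtACBudget_aux_acSound : ∀ (n : ℕ) (F G : PICircuit ℂ (Fin n × Fin n)), HasPCProof F G (fun s => if s = PIAxiom.A6 ∨ s = PIAxiom.A7 ∨ s = PIAxiom.A8 ∨ s = PIAxiom.A9 ∨ s = PIAxiom.A10 then 0 else ⊤) → ACStability.ACEq F.unfold G.unfold := by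
  intro n F G h
  exact ACStability.acEq_unfold_of_hasPCProof (fun s hs => if_pos hs) h

end Summit.ValiantsHypothesis.ValiantsHypothesis.Theorems
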